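import Summits.CriticalPhenomena.PercolationContinuityZ3.Theorems.PercNearOneGluingNoHeavyLowerTailCILEventGluing
import Summits.CriticalPhenomena.PercolationContinuityZ3.Theorems.PercNearOneGluingNoHeavyLowerTailCILTransfer
import Summits.CriticalPhenomena.PercolationContinuityZ3.Theses.PercNearOneGluing
import HarnessLib

/-!
# `NoHeavyLowerTail` (stmt-CriticalPhenomena-4575) — the cumulative isolation lemma at the half level
# IMPLIES the crux `AdditiveGluing` (stmt-CriticalPhenomena-4576)

Support file (depth prover nh-dp-blobmono gen 2; `--supports stmt-CriticalPhenomena-4575`).  No definitions,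
no named facts, no sorries.

`…CILEventGluing` showed: the half-level cumulative isolation lemma `CIL_half` (the hypothesis of the
lead's reduction `Theorems.noHeavyLowerTail_of_cumulativeIsolation`, verbatim) gives event gluing and the
additive-gluing inequality on every graph CARRYING a glued block of `|A'| + 1` vertices through the sink.
This file removes that proviso by the pendant-block extension: a weighted graph on `Fin n` is embedded in
`Fin (n + m)` (`Fin.castAdd m`), the `m` new vertices are hung on the sink `b` by weight-`1` edges and joined
to nothing else; then

* (`…CILTransfer`) the restriction of `prodBernoulli w'` to the old pairs is `prodBernoulli w`, and old
  vertices are connected in `ω'` iff they are connected in the restricted configuration whenever no open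
  pair joins an old vertex other than `b` to a new vertex (which holds a.s., those weights being `0`);
* hence connection probabilities among old vertices are unchanged, the block `{b} ∪ new` is a.s. connected,
  and `eventGluing_of_cumulativeIsolationHalf` applies; the additive form follows by
  `μ(o ↔ A) ≤ μ({o ↮ b} ∩ ⋃_{a ≠ b} {o ↔ a}) + μ(o ↔ b)`.

Main theorems: `additiveGluing_of_cumulativeIsolationHalf : CIL_half → AdditiveGluing` and, with the registered
stub signature verbatim, `additiveGluing_of_stub_cumulativeIsolation : stub_cumulativeIsolation → AdditiveGluing`
— the engine of crux 4575 as typed by the lead implies crux 4576 outright (the two cruxes are nested).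
-/

noncomputable section

namespace Summit.CriticalPhenomena.PercolationContinuityZ3.Theorems

open MeasureTheory Set Literature.Probability.LatticeModels Literature.Probability.Percolation
open scoped Classical BigOperators



open CILTransfer CILEventGluing

/-- **CIL at the half level implies the crux `AdditiveGluing` (stmt-CriticalPhenomena-4576).**
Hypothesis: the half-level cumulative isolation lemma, verbatim as consumed by
`Theorems.noHeavyLowerTail_of_cumulativeIsolation`.  Proof: for `(n, w, A, o, b, t)`, the cases `o ∈ A`
and `o = b` are immediate; otherwise put `A' = A ∖ {b}`, hang `m = |A'|` new vertices on `b` by weight-`1`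
edges (`Fin (n + m)`, all other new pairs weight `0`), transfer all connection probabilities among old
vertices (`CILTransfer.real_preimage_restrict`, `CILTransfer.reachable_castAdd_iff`, a.s. support), and
apply `additiveGluing_glued_of_cumulativeIsolationHalf` to the glued block `{b} ∪ new`. [folklore] -/
theorem additiveGluing_of_cumulativeIsolationHalf
    (hCIL : ∀ (n : ℕ) (w : Sym2 (Fin n) → unitInterval) (A : Finset (Fin n)) (o : Fin n),
      A.Nonempty → o ∉ A → ∃ a ∈ A,
        (prodBernoulli w).real {ω : BondConfig (Fin n) |
            1 ≤ (A.filter fun x => ω ∈ openConn o x).card ∧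
              2 * (A.filter fun x => ω ∈ openConn o x).card ≤ A.card} ≤
          (prodBernoulli w).real {ω : BondConfig (Fin n) |
            2 * (A.filter fun x => ω ∈ openConn a x).card ≤ A.card}) :
    Summit.CriticalPhenomena.PercolationContinuityZ3.Theses.PercNearOneGluing.AdditiveGluing := by
  intro n w A o b t ht hrel
  set μ := prodBernoulli w with hμ
  haveI : IsProbabilityMeasure μ := by rw [hμ]; infer_instance
  -- trivial cases
  by_cases hoA : o ∈ A
  · have h1 : μ.real (⋃ a ∈ A, (openConn o a : Set (BondConfig (Fin n)))) ≤ 1 := measureReal_le_one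
    have h2 := hrel o hoA
    linarith
  by_cases hob : o = b
  · subst hob
    have h1 : μ.real (⋃ a ∈ A, (openConn o a : Set (BondConfig (Fin n)))) ≤ 1 := measureReal_le_one
    have h2 : μ.real (openConn o o : Set (BondConfig (Fin n))) = 1 := by
      have : (openConn o o : Set (BondConfig (Fin n))) = Set.univ :=
        Set.eq_univ_of_forall fun ω => (SimpleGraph.Reachable.refl o : (openGraph ω).Reachable o o)
      rw [this, probReal_univ]
    linarith
  -- the extension
  set A' := A.erase b with hA'
  set m := A'.card with hm
  set ι := Fin.castAdd m with hι          -- old vertices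
  set ν := Fin.natAdd n with hν           -- new vertices (`Fin m → Fin (n + m)`)
  set f : Sym2 (Fin n) → Sym2 (Fin (n + m)) := Sym2.map ι with hf
  have hfinj : Function.Injective f := Sym2.map.injective (Fin.castAdd_injective _ _)
  -- new weights: old pairs keep their weight, pairs inside the block `{ι b} ∪ new` get weight 1, the rest 0
  set Dnew : Finset (Fin (n + m)) := insert (ι b) (Finset.univ.image ν) with hDnew
  set w' : Sym2 (Fin (n + m)) → unitInterval := fun e' =>
    if h : ∃ e, f e = e' then w h.choose
    else if ∀ x ∈ e', x ∈ Dnew then 1 else 0 with hw'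
  set μ' := prodBernoulli w' with hμ'
  haveI : IsProbabilityMeasure μ' := by rw [hμ']; infer_instance
  -- (a) `w' ∘ f = w`
  have hwf : w' ∘ f = w := by
    funext e
    have hex : ∃ e₀, f e₀ = f e := ⟨e, rfl⟩
    simp only [Function.comp_apply, hw', dif_pos hex]
    congr 1
    exact hfinj hex.choose_spec
  -- (b) transfer of events: `μ' {ω' | f ⁻¹' ω' ∈ E} = μ E`
  have htrans : ∀ E : Set (BondConfig (Fin n)),
      μ'.real ((fun ω' : Set (Sym2 (Fin (n + m))) => f ⁻¹' ω') ⁻¹' E) = μ.real E := by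
    intro E
    rw [hμ', real_preimage_restrict f hfinj w' E, hwf]
  -- (c) a.s. support: no open pair between an old vertex `≠ b` and a new vertex
  have hzero : ∀ (u : Fin n) (i : Fin m), u ≠ b → w' s(ι u, ν i) = 0 := by
    intro u i hub
    have hnex : ¬ ∃ e, f e = s(ι u, ν i) := by
      rintro ⟨e, he⟩
      have : ν i ∈ Sym2.map ι e := by rw [← hf, he]; exact Sym2.mem_mk_right _ _
      obtain ⟨x, -, hx⟩ := Sym2.mem_map.1 this
      exact absurd (congrArg Fin.val hx) (by simp [hι, hν, Fin.val_castAdd, Fin.val_natAdd]; omega)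
    have hnall : ¬ ∀ x ∈ s(ι u, ν i), x ∈ Dnew := by
      intro hall
      have hu := hall (ι u) (Sym2.mem_mk_left _ _)
      rw [hDnew, Finset.mem_insert, Finset.mem_image] at hu
      rcases hu with hu | ⟨j, -, hj⟩
      · exact hub (Fin.castAdd_injective _ _ hu)
      · exact absurd (congrArg Fin.val hj) (by simp [hι, hν, Fin.val_castAdd, Fin.val_natAdd]; omega)
    simp only [hw', dif_neg hnex, if_neg hnall]
  have hsupp : ∀ᵐ ω' ∂μ', ∀ (u : Fin n) (i : Fin m), s(ι u, ν i) ∈ ω' → u = b := by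
    have h := prodBernoulli_ae_forall_notMem w'
      (Z := {e' | ∃ (u : Fin n) (i : Fin m), u ≠ b ∧ e' = s(ι u, ν i)}) (Set.to_countable _)
      (by rintro e' ⟨u, i, hub, rfl⟩; exact hzero u i hub)
    filter_upwards [h] with ω' hω' u i hmem
    by_contra hub
    exact hω' _ ⟨u, i, hub, rfl⟩ hmem
  -- (d) connection events among old vertices transfer
  have hconn : ∀ u v : Fin n, μ'.real (openConn (ι u) (ι v) : Set (BondConfig (Fin (n + m)))) =
      μ.real (openConn u v : Set (BondConfig (Fin n))) := by
    intro u v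
    rw [← htrans]
    refine measureReal_congr (Filter.eventuallyEq_set.2 ?_)
    filter_upwards [hsupp] with ω' hω'
    exact reachable_castAdd_iff ω' b hω' u v
  have hunion : μ'.real (⋃ a ∈ A, (openConn (ι o) (ι a) : Set (BondConfig (Fin (n + m))))) =
      μ.real (⋃ a ∈ A, (openConn o a : Set (BondConfig (Fin n)))) := by
    rw [← htrans]
    refine measureReal_congr (Filter.eventuallyEq_set.2 ?_)
    filter_upwards [hsupp] with ω' hω'
    simp only [Set.mem_iUnion, Set.mem_preimage, exists_prop]
    exact exists_congr fun a => and_congr_right fun _ => reachable_castAdd_iff ω' b hω' o a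
  -- (e) the block `Dnew` is glued: pairwise-null disconnections
  have hone : ∀ i : Fin m, w' s(ι b, ν i) = 1 := by
    intro i
    have hnex : ¬ ∃ e, f e = s(ι b, ν i) := by
      rintro ⟨e, he⟩
      have : ν i ∈ Sym2.map ι e := by rw [← hf, he]; exact Sym2.mem_mk_right _ _
      obtain ⟨x, -, hx⟩ := Sym2.mem_map.1 this
      exact absurd (congrArg Fin.val hx) (by simp [hι, hν, Fin.val_castAdd, Fin.val_natAdd]; omega)
    have hall : ∀ x ∈ s(ι b, ν i), x ∈ Dnew := by
      intro x hx
      rcases Sym2.mem_iff.1 hx with rfl | rfl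
      · exact Finset.mem_insert_self _ _
      · exact Finset.mem_insert_of_mem (Finset.mem_image.2 ⟨i, Finset.mem_univ _, rfl⟩)
    simp only [hw', dif_neg hnex, if_pos hall]
  have hedge : ∀ i : Fin m, μ'.real {ω' : BondConfig (Fin (n + m)) | s(ι b, ν i) ∉ ω'} = 0 := by
    intro i
    rw [hμ', prodBernoulli_real_setOf_notMem, hone]
    simp
  have hbnew : ∀ i : Fin m, μ'.real (openConn (ι b) (ν i) : Set (BondConfig (Fin (n + m))))ᶜ = 0 := by
    intro i
    apply le_antisymm _ measureReal_nonneg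
    calc μ'.real (openConn (ι b) (ν i) : Set (BondConfig (Fin (n + m))))ᶜ
        ≤ μ'.real {ω' : BondConfig (Fin (n + m)) | s(ι b, ν i) ∉ ω'} := by
          refine measureReal_mono fun ω' hω' hmem => hω' ?_
          have hne : ι b ≠ ν i := fun h =>
            absurd (congrArg Fin.val h) (by simp [hι, hν, Fin.val_castAdd, Fin.val_natAdd]; omega)
          exact SimpleGraph.Adj.reachable ((SimpleGraph.fromEdgeSet_adj _).2 ⟨hmem, hne⟩)
      _ = 0 := hedge i
  have hglue : ∀ u ∈ Dnew, ∀ v ∈ Dnew,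
      μ'.real (openConn u v : Set (BondConfig (Fin (n + m))))ᶜ = 0 := by
    -- every block vertex is a.s. joined to `ι b`
    have hto : ∀ u ∈ Dnew, μ'.real (openConn (ι b) u : Set (BondConfig (Fin (n + m))))ᶜ = 0 := by
      intro u hu
      rw [hDnew, Finset.mem_insert, Finset.mem_image] at hu
      rcases hu with rfl | ⟨i, -, rfl⟩
      · have hempty : (openConn (ι b) (ι b) : Set (BondConfig (Fin (n + m))))ᶜ = ∅ := by
          rw [Set.compl_empty_iff]
          exact Set.eq_univ_of_forall fun ω' =>
            (SimpleGraph.Reachable.refl _ : (openGraph ω').Reachable (ι b) (ι b))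
        rw [hempty, measureReal_empty]
      · exact hbnew i
    intro u hu v hv
    apply le_antisymm _ measureReal_nonneg
    calc μ'.real (openConn u v : Set (BondConfig (Fin (n + m))))ᶜ
        ≤ μ'.real ((openConn (ι b) u : Set (BondConfig (Fin (n + m))))ᶜ ∪
            (openConn (ι b) v : Set (BondConfig (Fin (n + m))))ᶜ) := by
          refine measureReal_mono fun ω' hω' => ?_
          by_contra hnot
          simp only [Set.mem_union, Set.mem_compl_iff, not_or, not_not] at hnot
          exact hω' ((hnot.1 : (openGraph ω').Reachable _ _).symm.trans hnot.2)
      _ ≤ μ'.real (openConn (ι b) u : Set (BondConfig (Fin (n + m))))ᶜ +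
            μ'.real (openConn (ι b) v : Set (BondConfig (Fin (n + m))))ᶜ := measureReal_union_le _ _
      _ = 0 := by rw [hto u hu, hto v hv, add_zero]
  -- (f) apply the glued theorem on `Fin (n + m)`
  have hcardD : Dnew.card = (A'.image ι).card + 1 := by
    rw [hDnew, Finset.card_insert_of_notMem, Finset.card_image_of_injective _ (Fin.natAdd_injective _ _),
      Finset.card_univ, Fintype.card_fin, Finset.card_image_of_injective _ (Fin.castAdd_injective _ _), hm]
    rw [Finset.mem_image]
    rintro ⟨i, -, hi⟩
    exact absurd (congrArg Fin.val hi) (by simp [hι, hν, Fin.val_castAdd, Fin.val_natAdd]; omega)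
  have hdisjD : Disjoint (A'.image ι) Dnew := by
    rw [Finset.disjoint_left]
    intro x hx hxD
    obtain ⟨a, ha, rfl⟩ := Finset.mem_image.1 hx
    rw [hDnew, Finset.mem_insert, Finset.mem_image] at hxD
    rcases hxD with h | ⟨i, -, hi⟩
    · exact (Finset.mem_erase.1 ha).1 (Fin.castAdd_injective _ _ h)
    · exact absurd (congrArg Fin.val hi) (by simp [hι, hν, Fin.val_castAdd, Fin.val_natAdd]; omega)
  have hoA'' : ι o ∉ A'.image ι := by
    rw [Finset.mem_image]
    rintro ⟨a, ha, h⟩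
    exact hoA (Finset.mem_of_mem_erase (Fin.castAdd_injective _ _ h ▸ ha))
  have hoD : ι o ∉ Dnew := by
    rw [hDnew, Finset.mem_insert, Finset.mem_image]
    rintro (h | ⟨i, -, hi⟩)
    · exact hob (Fin.castAdd_injective _ _ h)
    · exact absurd (congrArg Fin.val hi) (by simp [hι, hν, Fin.val_castAdd, Fin.val_natAdd]; omega)
  have hrel' : ∀ a ∈ A'.image ι, 1 - t ≤ μ'.real (openConn a (ι b) : Set (BondConfig (Fin (n + m)))) := by
    intro x hx
    obtain ⟨a, ha, rfl⟩ := Finset.mem_image.1 hx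
    rw [hconn]
    exact hrel a (Finset.mem_of_mem_erase ha)
  -- `μ(o ↔ A) ≤ μ({o ↮ b} ∩ ⋃_{A'} {o ↔ a}) + μ(o ↔ b)`
  have hB : μ.real (⋃ a ∈ A, (openConn o a : Set (BondConfig (Fin n)))) ≤
      μ.real ((openConn o b : Set (BondConfig (Fin n)))ᶜ ∩ ⋃ a ∈ A', (openConn o a : Set (BondConfig (Fin n)))) +
        μ.real (openConn o b : Set (BondConfig (Fin n))) := by
    calc μ.real (⋃ a ∈ A, (openConn o a : Set (BondConfig (Fin n))))
        ≤ μ.real (((openConn o b : Set (BondConfig (Fin n)))ᶜ ∩ ⋃ a ∈ A', (openConn o a : Set (BondConfig (Fin n)))) ∪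
            (openConn o b : Set (BondConfig (Fin n)))) := by
          refine measureReal_mono fun ω hω => ?_
          by_cases hob' : ω ∈ (openConn o b : Set (BondConfig (Fin n)))
          · exact Or.inr hob'
          · obtain ⟨a, ha, hoa⟩ := Set.mem_iUnion₂.1 hω
            have hab : a ≠ b := by rintro rfl; exact hob' hoa
            exact Or.inl ⟨hob', Set.mem_iUnion₂.2 ⟨a, Finset.mem_erase.2 ⟨hab, ha⟩, hoa⟩⟩
      _ ≤ _ := measureReal_union_le _ _
  by_cases hA'ne : A'.Nonempty
  · -- event gluing on the extension, transferred back
    have hne' : (A'.image ι).Nonempty := hA'ne.image _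
    obtain ⟨x, hx, hEG⟩ := eventGluing_of_cumulativeIsolationHalf hCIL w' (A'.image ι) Dnew (ι o) (ι b)
      (Finset.mem_insert_self _ _) hcardD hdisjD hoA'' hoD hglue hne'
    obtain ⟨a₀, ha₀, rfl⟩ := Finset.mem_image.1 hx
    rw [Finset.set_biUnion_finset_image] at hEG
    -- transfer the two sides
    have hL : μ'.real ((openConn (ι o) (ι b) : Set (BondConfig (Fin (n + m))))ᶜ ∩
        ⋃ a ∈ A', (openConn (ι o) (ι a) : Set (BondConfig (Fin (n + m))))) =
        μ.real ((openConn o b : Set (BondConfig (Fin n)))ᶜ ∩ ⋃ a ∈ A', (openConn o a : Set (BondConfig (Fin n)))) := by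
      rw [← htrans]
      refine measureReal_congr (Filter.eventuallyEq_set.2 ?_)
      filter_upwards [hsupp] with ω' hω'
      simp only [Set.mem_inter_iff, Set.mem_compl_iff, Set.mem_iUnion, Set.mem_preimage, exists_prop]
      refine and_congr (not_congr (reachable_castAdd_iff ω' b hω' o b)) ?_
      exact exists_congr fun a => and_congr_right fun _ => reachable_castAdd_iff ω' b hω' o a
    have hR : μ'.real (openConn (ι a₀) (ι b) : Set (BondConfig (Fin (n + m))))ᶜ =
        μ.real (openConn a₀ b : Set (BondConfig (Fin n)))ᶜ := by
      rw [measureReal_compl (μ := μ') MeasurableSet.of_discrete, measureReal_compl (μ := μ) MeasurableSet.of_discrete,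
        probReal_univ, probReal_univ, hconn]
    rw [hL, hR] at hEG
    -- `μ{a₀ ↮ b} ≤ t`
    have hcut : μ.real (openConn a₀ b : Set (BondConfig (Fin n)))ᶜ ≤ t := by
      have h := measureReal_compl (μ := μ) (s := (openConn a₀ b : Set (BondConfig (Fin n))))
        MeasurableSet.of_discrete
      rw [probReal_univ] at h
      have := hrel a₀ (Finset.mem_of_mem_erase ha₀)
      linarith
    linarith
  · rw [Finset.not_nonempty_iff_eq_empty.1 hA'ne] at hB
    simp only [Finset.notMem_empty, Set.iUnion_of_empty, Set.iUnion_empty, Set.inter_empty,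
      measureReal_empty, zero_add] at hB
    linarith

/-- **The registered stub `stub_cumulativeIsolation` (all levels) implies the crux `AdditiveGluing`
(stmt-CriticalPhenomena-4576).**  Instantiate the level `j := ⌊|A|/2⌋` (`N ≤ ⌊|A|/2⌋ ↔ 2N ≤ |A|`) and apply
`additiveGluing_of_cumulativeIsolationHalf`. [folklore] -/
theorem additiveGluing_of_stub_cumulativeIsolation
    (hCIL : ∀ (n : ℕ) (w : Sym2 (Fin n) → unitInterval) (A : Finset (Fin n)) (o : Fin n) (j : ℕ),
      A.Nonempty → o ∉ A → ∃ a ∈ A,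
        (Literature.Probability.LatticeModels.prodBernoulli w).real
            {ω : Literature.Probability.Percolation.BondConfig (Fin n) |
              1 ≤ (A.filter fun x => ω ∈ Literature.Probability.Percolation.openConn o x).card ∧
                (A.filter fun x => ω ∈ Literature.Probability.Percolation.openConn o x).card ≤ j} ≤
          (Literature.Probability.LatticeModels.prodBernoulli w).real
            {ω : Literature.Probability.Percolation.BondConfig (Fin n) |
              (A.filter fun x => ω ∈ Literature.Probability.Percolation.openConn a x).card ≤ j}) :
    Summit.CriticalPhenomena.PercolationContinuityZ3.Theses.PercNearOneGluing.AdditiveGluing := by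
  refine additiveGluing_of_cumulativeIsolationHalf fun n w A o hA ho => ?_
  obtain ⟨a, ha, hle⟩ := hCIL n w A o (A.card / 2) hA ho
  refine ⟨a, ha, ?_⟩
  have e1 : {ω : BondConfig (Fin n) |
      1 ≤ (A.filter fun x => ω ∈ openConn o x).card ∧
        2 * (A.filter fun x => ω ∈ openConn o x).card ≤ A.card} =
      {ω : BondConfig (Fin n) |
        1 ≤ (A.filter fun x => ω ∈ openConn o x).card ∧
          (A.filter fun x => ω ∈ openConn o x).card ≤ A.card / 2} := by
    ext ω; simp only [Set.mem_setOf_eq]; omega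
  have e2 : {ω : BondConfig (Fin n) | 2 * (A.filter fun x => ω ∈ openConn a x).card ≤ A.card} =
      {ω : BondConfig (Fin n) | (A.filter fun x => ω ∈ openConn a x).card ≤ A.card / 2} := by
    ext ω; simp only [Set.mem_setOf_eq]; omega
  rw [e1, e2]
  exact hle

end Summit.CriticalPhenomena.PercolationContinuityZ3.Theorems

end
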